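import Literature.NumberTheory.Irrationality.Lai2025TwoAdic.PhiLowerBound
import Literature.NumberTheory.Irrationality.Hata1992.FractionalPartWindows
import HarnessLib

/-!
# Lai 2025 (IJNT), Lemma 5.1 in full: `log Φ_n / n → 2 log 2 − 1` — PROVED

Topic `Literature/NumberTheory/Irrationality/Lai2025TwoAdic`.  Source: L. Lai, *On the irrationality of certain `2`-adic
zeta values*, Int. J. Number Theory (2025) = arXiv:2304.00816 [Lai2025TwoAdicZeta], Lemma 5.1 and its proof (held text
`paper:arxiv-2304.00816`, chunk p0010, read on the page).  PROOF FILE (theorems only; no definition, no named fact).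
Companion of `PhiLowerBound.lean` (which proves the weaker `Φ_n ≥ e^{n/4}` used for Theorem 1.2 and records the full rate
as a TODO): here the full printed asymptotics, by the printed argument, on the tree's fractional-part window engine
`Hata1992.fracProd` / `Hata1992.tendsto_log_fracProd_div_digamma` (prime number theorem window by window + Chebyshev's
bound for the tail) and Mathlib's digamma values `ψ(1) = −γ`, `ψ(½) = −2 log 2 − γ`.

## Source, as printed ([Lai2025TwoAdicZeta, Lemma 5.1])

**Lemma 5.1.** «We have the following asymptotic estimate of the factor `Φ_n` defined in (def_Phi):
`|Φ_n| = exp((2 log 2 − 1 + o(1))n)` as `n → ∞`.»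

*Proof (printed).* «… `log Φ_n = Σ_{√(10n) < q ≤ n, {n/q} > ½} log q = Σ_{q ≤ n, {n/q} > ½} log q + O(√n)`.  It suffices to
show that `L_n := Σ_{q ≤ n, {n/q} > ½} log q = (2 log 2 − 1 + o(1))n`.  In fact, we have
`L_n = Σ_{k=1}^{∞} Σ_{k+½ < n/q < k+1} log q = Σ_{k=1}^{∞} Σ_{n/(k+1) < q < n/(k+½)} log q`. … Then (PNT) implies …
Letting `K → ∞` we obtain `L_n = n Σ_{k=1}^{∞}(1/(k+½) − 1/(k+1)) + o(n) = (2 log 2 − 1)n + o(n)`, as desired.»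

## What is formalised (all PROVED)

With `F_n := Hata1992.fracProd ½ 1 1 n = ∏_{k=1}^{n} ∏_{n/(k+1) < q ≤ n/(k+½)} q` (the primes `q ≤ 2n/3` with `{n/q} ≥ ½`,
i.e. `e^{L_n}` up to the prime `2`):
* `log_PhiL_le_log_fracProd`: `log Φ_n ≤ log F_n` (a prime `q` of `Φ_n` lies in the window `k = ⌊n/q⌋ ≥ 1`);
* `log_fracProd_le`: `log F_n ≤ log Φ_n + θ(√(10n))` (a window prime not in `Φ_n` has `q² ≤ 10n`: either `q ≤ √(10n)`, or
  `{n/q} = ½`, i.e. `q = 2`) — the printed `O(√n)`, via Chebyshev `θ(x) ≤ x log 4`;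
* `tendsto_log_PhiL_div_fracRate`: `log Φ_n / n → Σ_{k ≥ 1}(1/(k+½) − 1/(k+1))` (`Hata1992.tendsto_log_fracProd_div`);
* `fracRate_half_one_one`: that series is `ψ(2) − ψ(3/2) = 2 log 2 − 1` (`Hata1992.fracRate_eq_digamma`, Mathlib's
  `Complex.digamma_one`, `Complex.digamma_one_half`, `Complex.digamma_apply_add_one`);
* **Lemma 5.1** `tendsto_log_PhiL_div`: `log Φ_n / n → 2 log 2 − 1`, and the two `ε`-forms `eventually_exp_rate_le_PhiL`,
  `eventually_PhiL_le_exp_rate`.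

Cell zeta5-irr / pub-zeta5 (HONEST FRAMING): an auxiliary prime-number-theorem estimate of a PUBLISHED proof
[Lai2025TwoAdicZeta]; nothing here bears on `ζ(5) ∈ ℝ`.
-/

noncomputable section

open Finset Filter Topology
open Literature.NumberTheory.Irrationality.Hata1992

namespace Literature.NumberTheory.Irrationality.Lai2025TwoAdic

/-! ## §1. `Φ_n` versus the window product `F_n = ∏_{k ≥ 1} ∏_{n/(k+1) < q ≤ n/(k+½)} q` -/

/-- The window factor of `F_n` in logarithms: `log ∏_{n/(k+1) < q ≤ n/(k+½)} q = Σ log q` over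
`Hata1992.windowPrimes (1/(k+1)) (1/(k+½)) n`. [cite: Lai2025TwoAdicZeta, Lemma 5.1 (proof: the inner sums of L_n)] -/
theorem log_fracWindow_half_one (k n : ℕ) :
    Real.log (fracWindow (1 / 2 : ℝ) 1 k n : ℕ) =
      ∑ p ∈ windowPrimes (1 / ((k : ℝ) + 1)) (1 / ((k : ℝ) + 1 / 2)) n, Real.log (p : ℝ) := by
  unfold fracWindow
  exact log_windowProd_eq_sum _ _ _

/-- **`log Φ_n ≤ log F_n`**: every prime `q` of `Φ_n` (`q ≤ n`, `{n/q} > ½`) lies in the window `k = ⌊n/q⌋ ≥ 1`: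
`n/(k+1) < q ≤ n/(k+½)`. [cite: Lai2025TwoAdicZeta, Lemma 5.1 (proof: "log Φ_n = Σ_{√(10n)<q≤n, {n/q}>½} log q" ≤ L_n)] -/
theorem log_PhiL_le_log_fracProd (n : ℕ) :
    Real.log (PhiL n : ℝ) ≤ Real.log (fracProd (1 / 2 : ℝ) 1 1 n : ℕ) := by
  rw [log_PhiL, log_fracProd]
  have hmaps : ∀ q ∈ phiPrimes n, n / q ∈ Ico 1 (n + 1) := by
    intro q hq
    obtain ⟨hqn, hqp, -, -⟩ := mem_phiPrimes.1 hq
    rw [mem_Ico]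
    exact ⟨Nat.div_pos hqn hqp.pos, Nat.lt_succ_of_le (Nat.div_le_self n q)⟩
  rw [← sum_fiberwise_of_maps_to hmaps]
  refine sum_le_sum fun k hk => ?_
  rw [log_fracWindow_half_one]
  refine sum_le_sum_of_subset_of_nonneg (fun q hq => ?_)
    (fun p hp _ => Real.log_nonneg (by exact_mod_cast (prime_of_mem_windowPrimes hp).one_lt.le))
  rw [mem_filter] at hq
  obtain ⟨hq, hk⟩ := hq
  subst hk
  obtain ⟨-, hqp, -, h2⟩ := mem_phiPrimes.1 hq
  have hdm : q * (n / q) + n % q = n := Nat.div_add_mod n q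
  have hr : n % q < q := Nat.mod_lt n hqp.pos
  have h1 : n < q * (n / q) + q := by omega
  have h3 : 2 * (q * (n / q)) + q ≤ 2 * n := by omega
  have h1' : (n : ℝ) < (q : ℝ) * ((n / q : ℕ) : ℝ) + q := by exact_mod_cast h1
  have h3' : 2 * ((q : ℝ) * ((n / q : ℕ) : ℝ)) + q ≤ 2 * n := by exact_mod_cast h3
  have hk0 : (0 : ℝ) < ((n / q : ℕ) : ℝ) + 1 := by positivity
  have hk2 : (0 : ℝ) < ((n / q : ℕ) : ℝ) + 1 / 2 := by positivity
  rw [mem_windowPrimes_iff (by positivity)]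
  refine ⟨hqp, ?_, ?_⟩
  · rw [div_mul_eq_mul_div, one_mul, div_lt_iff₀ hk0]
    linarith
  · rw [div_mul_eq_mul_div, one_mul, le_div_iff₀ hk2]
    linarith

/-- **`log F_n ≤ log Φ_n + θ(√(10n))`** (the printed `+ O(√n)`): a window prime (`k ≥ 1`) is `≤ n` with `2(n mod q) ≥ q`,
and if it is not a prime of `Φ_n` then `q² ≤ 10n` (either `q ≤ √(10n)` fails the cut-off, or `q = 2(n mod q)` forces
`q = 2`). [cite: Lai2025TwoAdicZeta, Lemma 5.1 (proof: "= Σ_{q≤n, {n/q}>½} log q + O(√n)")] -/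
theorem log_fracProd_le (n : ℕ) :
    Real.log (fracProd (1 / 2 : ℝ) 1 1 n : ℕ) ≤
      Real.log (PhiL n : ℝ) + Chebyshev.theta (Real.sqrt (10 * n)) := by
  classical
  rw [log_PhiL, log_fracProd]
  set V : Finset ℕ := ((range (n + 1)).filter Nat.Prime).filter (fun p => p ≤ 2 * (n % p)) with hV
  set A : Finset ℕ := (Ioc 0 ⌊Real.sqrt (10 * n)⌋₊).filter Nat.Prime with hA
  have hθ : Chebyshev.theta (Real.sqrt (10 * n)) = ∑ p ∈ A, Real.log (p : ℝ) := rfl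
  have hmemV : ∀ {p : ℕ}, p ∈ V ↔ (p ≤ n ∧ p.Prime) ∧ p ≤ 2 * (n % p) := by
    intro p; rw [hV, mem_filter, mem_filter, mem_range, Nat.lt_succ_iff]
  have hmaps : ∀ p ∈ V, n / p ∈ Ico 1 (n + 1) := by
    intro p hp
    obtain ⟨⟨hpn, hpp⟩, -⟩ := hmemV.1 hp
    rw [mem_Ico]
    exact ⟨Nat.div_pos hpn hpp.pos, Nat.lt_succ_of_le (Nat.div_le_self n p)⟩
  -- each window lies in the corresponding fiber of `V`
  have hwin : ∀ k ∈ Ico 1 (n + 1),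
      Real.log (fracWindow (1 / 2 : ℝ) 1 k n : ℕ) ≤ ∑ p ∈ V with n / p = k, Real.log (p : ℝ) := by
    intro k hk
    have hk1 : 1 ≤ k := (mem_Ico.1 hk).1
    rw [log_fracWindow_half_one]
    refine sum_le_sum_of_subset_of_nonneg (fun p hp => ?_) (fun p hp _ => Real.log_nonneg ?_)
    · have hk0 : (0 : ℝ) < (k : ℝ) + 1 := by positivity
      have hk2 : (0 : ℝ) < (k : ℝ) + 1 / 2 := by positivity
      obtain ⟨hpp, h1, h2⟩ := (mem_windowPrimes_iff (by positivity)).1 hp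
      rw [div_mul_eq_mul_div, one_mul, div_lt_iff₀ hk0] at h1
      rw [div_mul_eq_mul_div, one_mul, le_div_iff₀ hk2] at h2
      have hA' : n < k * p + p := by
        have h' : (n : ℝ) < (k * p + p : ℕ) := by push_cast; linarith
        exact_mod_cast h'
      have hB' : 2 * (k * p) + p ≤ 2 * n := by
        have h' : ((2 * (k * p) + p : ℕ) : ℝ) ≤ (2 * n : ℕ) := by push_cast; linarith
        exact_mod_cast h'
      have hdiv : n / p = k := Nat.div_eq_of_lt_le (by linarith) (by linarith)
      have e : n % p + p * k = n := by
        have e := Nat.mod_add_div n p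
        rwa [hdiv] at e
      have epk : p * k = k * p := mul_comm _ _
      have hkp : p ≤ k * p := Nat.le_mul_of_pos_left p hk1
      rw [mem_filter, hmemV]
      refine ⟨⟨⟨by omega, hpp⟩, by omega⟩, hdiv⟩
    · rw [mem_filter] at hp
      exact_mod_cast (hmemV.1 hp.1).1.2.one_lt.le
  -- `V ⊆ Φ-primes ∪ primes ≤ √(10n)`
  have hsub : V ⊆ phiPrimes n ∪ A := by
    intro p hp
    obtain ⟨⟨hpn, hpp⟩, h2⟩ := hmemV.1 hp
    rw [mem_union]
    by_cases h : p ∈ phiPrimes n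
    · exact Or.inl h
    right
    have hsq : p * p ≤ 10 * n := by
      rw [mem_phiPrimes] at h
      by_contra hlt
      push Not at hlt
      have hne : ¬ p < 2 * (n % p) := fun h' => h ⟨hpn, hpp, hlt, h'⟩
      have he : p = 2 * (n % p) := by omega
      have h2p : 2 ∣ p := ⟨n % p, he⟩
      have hp2 : p = 2 := ((Nat.prime_dvd_prime_iff_eq Nat.prime_two hpp).1 h2p).symm
      rw [hp2] at hlt hpn
      omega
    have hreal : (p : ℝ) ≤ Real.sqrt (10 * n) := by
      rw [← Real.sqrt_sq (Nat.cast_nonneg p)]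
      exact Real.sqrt_le_sqrt (by rw [sq]; exact_mod_cast hsq)
    rw [hA, mem_filter, mem_Ioc]
    exact ⟨⟨hpp.pos, Nat.le_floor hreal⟩, hpp⟩
  have hlog0 : ∀ p ∈ phiPrimes n ∪ A, 0 ≤ Real.log (p : ℝ) := by
    intro p hp
    rcases mem_union.1 hp with h | h
    · exact Real.log_nonneg (by exact_mod_cast (mem_phiPrimes.1 h).2.1.one_lt.le)
    · exact Real.log_nonneg (by exact_mod_cast (mem_filter.1 h).2.one_lt.le)
  have hui := sum_union_inter (s₁ := phiPrimes n) (s₂ := A) (f := fun p : ℕ => Real.log (p : ℝ))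
  have hint : 0 ≤ ∑ p ∈ phiPrimes n ∩ A, Real.log (p : ℝ) :=
    sum_nonneg fun p hp => hlog0 p (mem_union.2 (Or.inl (mem_inter.1 hp).1))
  calc ∑ k ∈ Ico 1 (n + 1), Real.log (fracWindow (1 / 2 : ℝ) 1 k n : ℕ)
      ≤ ∑ k ∈ Ico 1 (n + 1), ∑ p ∈ V with n / p = k, Real.log (p : ℝ) := sum_le_sum hwin
    _ = ∑ p ∈ V, Real.log (p : ℝ) := sum_fiberwise_of_maps_to hmaps _
    _ ≤ ∑ p ∈ phiPrimes n ∪ A, Real.log (p : ℝ) :=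
        sum_le_sum_of_subset_of_nonneg hsub fun p hp _ => hlog0 p hp
    _ ≤ ∑ p ∈ phiPrimes n, Real.log (p : ℝ) + Chebyshev.theta (Real.sqrt (10 * n)) := by
        rw [hθ]; linarith

/-! ## §2. The limit -/

/-- `θ(√(10n))/n → 0` (Chebyshev: `θ(x) ≤ x log 4`). [cite: Lai2025TwoAdicZeta, Lemma 5.1 (proof: "+ O(√n)")] -/
theorem tendsto_theta_sqrt_div :
    Tendsto (fun n : ℕ => Chebyshev.theta (Real.sqrt (10 * n)) / n) atTop (𝓝 0) := by
  have h1 : Tendsto (fun n : ℕ => Real.log 4 * Real.sqrt (10 / (n : ℝ))) atTop (𝓝 0) := by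
    have h := ((tendsto_const_div_atTop_nhds_zero_nat (10 : ℝ)).sqrt).const_mul (Real.log 4)
    simpa using h
  refine squeeze_zero' (Eventually.of_forall fun n =>
    div_nonneg (Chebyshev.theta_nonneg _) (Nat.cast_nonneg n)) ?_ h1
  filter_upwards [eventually_gt_atTop 0] with n hn
  have hn' : (0 : ℝ) < n := by exact_mod_cast hn
  have hsq : Real.sqrt (n : ℝ) ≠ 0 := (Real.sqrt_pos.2 hn').ne'
  rw [div_le_iff₀ hn']
  calc Chebyshev.theta (Real.sqrt (10 * n)) ≤ Real.log 4 * Real.sqrt (10 * n) :=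
        Chebyshev.theta_le_log4_mul_x (Real.sqrt_nonneg _)
    _ = Real.log 4 * Real.sqrt (10 / (n : ℝ)) * n := by
        rw [mul_assoc]
        congr 1
        have h4 : Real.sqrt (n : ℝ) ^ 2 = n := Real.sq_sqrt hn'.le
        rw [Real.sqrt_div' 10 hn'.le, Real.sqrt_mul (by norm_num : (0 : ℝ) ≤ 10)]
        field_simp
        exact h4

/-- **`log Φ_n / n → Σ_{k ≥ 1} (1/(k+½) − 1/(k+1))`** (the tree's window engine `Hata1992.tendsto_log_fracProd_div` for
`F_n`, and `0 ≤ log F_n − log Φ_n ≤ θ(√(10n)) = o(n)`). [cite: Lai2025TwoAdicZeta, Lemma 5.1 (proof)] -/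
theorem tendsto_log_PhiL_div_fracRate :
    Tendsto (fun n : ℕ => Real.log (PhiL n : ℝ) / n) atTop (𝓝 (fracRate (1 / 2 : ℝ) 1 1)) := by
  have hF := tendsto_log_fracProd_div (u := (1 / 2 : ℝ)) (v := 1) (by norm_num) (by norm_num) le_rfl 1
  have hdiff : Tendsto (fun n : ℕ =>
      (Real.log (fracProd (1 / 2 : ℝ) 1 1 n : ℕ) - Real.log (PhiL n : ℝ)) / n) atTop (𝓝 0) := by
    refine squeeze_zero' (Eventually.of_forall fun n =>
      div_nonneg (sub_nonneg.2 (log_PhiL_le_log_fracProd n)) (Nat.cast_nonneg n)) ?_ tendsto_theta_sqrt_div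
    refine Eventually.of_forall fun n => div_le_div_of_nonneg_right ?_ (Nat.cast_nonneg n)
    have := log_fracProd_le n
    linarith
  have h := hF.sub hdiff
  rw [sub_zero] at h
  refine h.congr fun n => ?_
  ring

/-- The series value: `Σ_{k ≥ 1} (1/(k+½) − 1/(k+1)) = ψ(2) − ψ(3/2) = 2 log 2 − 1` («`= (2 log 2 − 1)n + o(n)`»;
`ψ(2) = 1 − γ`, `ψ(3/2) = 2 − 2 log 2 − γ`). [cite: Lai2025TwoAdicZeta, Lemma 5.1 (proof, last display)] -/
theorem fracRate_half_one_one : fracRate (1 / 2 : ℝ) 1 1 = 2 * Real.log 2 - 1 := by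
  rw [fracRate_eq_digamma (by norm_num) (by norm_num) 1]
  have hne1 : ∀ m : ℕ, (1 : ℂ) ≠ -(m : ℂ) := by
    intro m h
    have h' := congrArg Complex.re h
    simp at h'
    linarith [(Nat.cast_nonneg m : (0 : ℝ) ≤ m)]
  have hne2 : ∀ m : ℕ, (1 / 2 : ℂ) ≠ -(m : ℂ) := by
    intro m h
    have h' := congrArg Complex.re h
    simp at h'
    linarith [(Nat.cast_nonneg m : (0 : ℝ) ≤ m)]
  have e1 : ((((1 : ℕ) : ℝ) + 1 : ℝ) : ℂ) = 1 + 1 := by push_cast; ring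
  have e2 : ((((1 : ℕ) : ℝ) + 1 / 2 : ℝ) : ℂ) = 1 / 2 + 1 := by push_cast; ring
  have hlog : Complex.log 2 = ((Real.log 2 : ℝ) : ℂ) := by
    rw [show (2 : ℂ) = ((2 : ℝ) : ℂ) by norm_num, ← Complex.ofReal_log (by norm_num)]
  rw [e1, e2, Complex.digamma_apply_add_one 1 hne1, Complex.digamma_apply_add_one (1 / 2) hne2,
    Complex.digamma_one, Complex.digamma_one_half, hlog]
  have hval : (-(Real.eulerMascheroniConstant : ℂ) + (1 : ℂ)⁻¹ -
      (-2 * ((Real.log 2 : ℝ) : ℂ) - (Real.eulerMascheroniConstant : ℂ) + (1 / 2 : ℂ)⁻¹)) =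
        ((2 * Real.log 2 - 1 : ℝ) : ℂ) := by
    push_cast; ring
  rw [hval, Complex.ofReal_re]

/-- **Lemma 5.1** (as printed): `log Φ_n / n → 2 log 2 − 1`, i.e. `Φ_n = e^{(2 log 2 − 1 + o(1))n}`.
[cite: Lai2025TwoAdicZeta, Lemma 5.1] -/
theorem tendsto_log_PhiL_div :
    Tendsto (fun n : ℕ => Real.log (PhiL n : ℝ) / n) atTop (𝓝 (2 * Real.log 2 - 1)) := by
  rw [← fracRate_half_one_one]
  exact tendsto_log_PhiL_div_fracRate

/-- Lemma 5.1, lower `ε`-form: `e^{(2 log 2 − 1 − ε)n} ≤ Φ_n` for all large `n`. [cite: Lai2025TwoAdicZeta, Lemma 5.1] -/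
theorem eventually_exp_rate_le_PhiL {ε : ℝ} (hε : 0 < ε) :
    ∀ᶠ n : ℕ in atTop, Real.exp ((2 * Real.log 2 - 1 - ε) * n) ≤ (PhiL n : ℝ) := by
  have h2 : ∀ᶠ n : ℕ in atTop, 2 * Real.log 2 - 1 - ε < Real.log (PhiL n : ℝ) / n :=
    tendsto_log_PhiL_div.eventually (eventually_gt_nhds (by linarith))
  filter_upwards [h2, eventually_gt_atTop 0] with n hn hn0
  have hn' : (0 : ℝ) < n := by exact_mod_cast hn0
  have hpos : (0 : ℝ) < (PhiL n : ℝ) := by exact_mod_cast PhiL_pos n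
  rw [lt_div_iff₀ hn'] at hn
  calc Real.exp ((2 * Real.log 2 - 1 - ε) * n) ≤ Real.exp (Real.log (PhiL n : ℝ)) :=
        Real.exp_le_exp.mpr hn.le
    _ = (PhiL n : ℝ) := Real.exp_log hpos

/-- Lemma 5.1, upper `ε`-form: `Φ_n ≤ e^{(2 log 2 − 1 + ε)n}` for all large `n`. [cite: Lai2025TwoAdicZeta, Lemma 5.1] -/
theorem eventually_PhiL_le_exp_rate {ε : ℝ} (hε : 0 < ε) :
    ∀ᶠ n : ℕ in atTop, (PhiL n : ℝ) ≤ Real.exp ((2 * Real.log 2 - 1 + ε) * n) := by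
  have h2 : ∀ᶠ n : ℕ in atTop, Real.log (PhiL n : ℝ) / n < 2 * Real.log 2 - 1 + ε :=
    tendsto_log_PhiL_div.eventually (eventually_lt_nhds (by linarith))
  filter_upwards [h2, eventually_gt_atTop 0] with n hn hn0
  have hn' : (0 : ℝ) < n := by exact_mod_cast hn0
  have hpos : (0 : ℝ) < (PhiL n : ℝ) := by exact_mod_cast PhiL_pos n
  rw [div_lt_iff₀ hn'] at hn
  calc (PhiL n : ℝ) = Real.exp (Real.log (PhiL n : ℝ)) := (Real.exp_log hpos).symm
    _ ≤ Real.exp ((2 * Real.log 2 - 1 + ε) * n) := Real.exp_le_exp.mpr hn.le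

end Literature.NumberTheory.Irrationality.Lai2025TwoAdic

end
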